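import Summits.AtomisticToContinuum.BoseEinsteinCondensation.Theorems.BECThomsonPrincipleGDTransferSeededSpectralDefs
import Summits.AtomisticToContinuum.BoseEinsteinCondensation.Theorems.BECThomsonPrincipleGDTransferSeededKineticBlockDiagonal
import Summits.AtomisticToContinuum.BoseEinsteinCondensation.Theorems.BECThomsonPrincipleGDTransferSeededInteractionLocality
import Summits.AtomisticToContinuum.BoseEinsteinCondensation.Theorems.BECThomsonPrincipleGDTransferSeededSharpCutSplitting
import Summits.AtomisticToContinuum.BoseEinsteinCondensation.Theorems.BECThomsonPrincipleGDTransferSeededSectorBlockAlgebra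

/-!
# Route `BECThomsonPrinciple`, crux `GDTransfer` (stmt-AtomisticToContinuum-9482), line `seeded-continuity`:
# sub-goal `smoothSplitting` of the spectral seed programme — IMS with a Lipschitz cut in the `n̂₀`-grading

Supports (does not close) stmt-AtomisticToContinuum-9482: proves the registered sub-goal
`smoothSplitting : SmoothSplitting` of the seventh Defs file `…SeededSpectralDefs`.

With `Ψ^{(n)} = Σ_{|S| = n} Q_SΨ` (`sectorBlock (· = n)`): `Ψ = Σ_n Ψ^{(n)}` and the smooth blocks are
`χ(n̂₀/N)Ψ = Σ_n χ(n/N) Ψ^{(n)}` (`smoothBlock_eq_sum`).  For a finite continuous finite-range profile all energy forms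
are finite and `𝓔(h) = Re t(h, h) + Re 𝓥(h, h)` (`PlainCost.eform_toReal_eq`); expanding sesquilinearly,
* the kinetic part of `𝓔(χ_loΨ) + 𝓔(χ_hiΨ) − E(Ψ)` is `Σ_{n,n'} (c_nc_{n'} + d_nd_{n'} − 1) Re t(Ψ^{(n)}, Ψ^{(n')}) = 0`:
  the sectors are `t`-orthogonal (`kineticBlockDiagonal`) and `c_n² + d_n² = 1` on the diagonal;
* the interaction part has coefficient `−½[(c_n − c_{n'})² + (d_n − d_{n'})²] ∈ [−K/2, 0]`, `K = 2π²/((1−β−θ)²N²)`,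
  for `|n − n'| ≤ 2` (Lipschitz cuts); the entries vanish for `|n − n'| ≥ 3` (`interactionLocality`) and are bounded
  by `(D_n + D_{n'})/2`, `D_n = ∫V|Ψ^{(n)}|²` (weighted Cauchy–Schwarz); five neighbours per row give
  `(5K/2)·Σ_n D_n ≤ 8π²/((1−β−θ)²N²) · D(Ψ)` (`ims_sum_le`).
All [folklore] (CyconFroeseKirschSimon1987 §3.1, IMS localisation; ReedSimonIV1978 §XIII.12; LSSY2005 App. A).
-/

noncomputable section

open MeasureTheory Filter
open scoped ENNReal NNReal ComplexConjugate

namespace Summit.AtomisticToContinuum.BoseEinsteinCondensation.Cruxes.GDTransfer.Seeded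

namespace SmoothCut

open Literature.MathematicalPhysics.QuantumManyBody.BoseGas
open Summit.AtomisticToContinuum.BoseEinsteinCondensation.Theorems.GaussianDominationCan.Negative (modeProj)
open Summit.AtomisticToContinuum.BoseEinsteinCondensation.Cruxes.GDTransfer.DysonDressedWitness
open ChordVariation (continuous_modeProj)
open Lnss (contDiff_modeProj sum_modeProj)

variable {m : ℕ} {L : ℝ} {v : ℝ → ℝ≥0∞}

/-! ## Scalars and double sums in the two sesquilinear forms -/

/-- A scalar in the first slot of the kinetic form comes out conjugated (differentiable data). [folklore] -/
theorem tform_const_mul_left (c : ℂ) {f : Config (m + 1) → ℂ} (hf : Differentiable ℝ f)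
    (g : Config (m + 1) → ℂ) : tform m L (fun X => c * f X) g = conj c * tform m L f g := by
  unfold tform
  rw [← integral_const_mul]
  refine integral_congr_ae (Eventually.of_forall fun X => ?_)
  have h : fderiv ℝ (fun Y => c * f Y) X = c • fderiv ℝ f X := fderiv_fun_const_smul (hf X) c
  simp only [h, smul_apply, smul_eq_mul, map_mul, Finset.mul_sum]
  exact Finset.sum_congr rfl fun j _ => Finset.sum_congr rfl fun a _ => by ring

/-- A scalar in the second slot of the kinetic form comes out (differentiable data). [folklore] -/
theorem tform_const_mul_right (c : ℂ) (f : Config (m + 1) → ℂ) {g : Config (m + 1) → ℂ}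
    (hg : Differentiable ℝ g) : tform m L f (fun X => c * g X) = c * tform m L f g := by
  rw [PlainCost.tform_conj_symm, tform_const_mul_left c hg, map_mul, Complex.conj_conj,
    ← PlainCost.tform_conj_symm]

/-- A block sum `X ↦ Σᵢ aᵢ Pᵢ(X)` is the `Finset` sum of the functions `aᵢPᵢ`. [folklore] -/
theorem blockSum_eq {ι : Type*} (s : Finset ι) (P : ι → Config (m + 1) → ℂ) (a : ι → ℝ) :
    (fun X => ∑ i ∈ s, (a i : ℂ) * P i X) = ∑ i ∈ s, fun X => (a i : ℂ) * P i X :=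
  funext fun X => (Finset.sum_apply X s fun i X => (a i : ℂ) * P i X).symm

/-- **Sesquilinear expansion of the kinetic form** over a finite family with real coefficients:
`t(Σ aᵢPᵢ, Σ b_jP_j) = Σᵢ Σ_j aᵢb_j t(Pᵢ, P_j)` (`C¹` data). [folklore] -/
theorem tform_sum_sum {ι : Type*} (s : Finset ι) {P : ι → Config (m + 1) → ℂ}
    (hP : ∀ i ∈ s, ContDiff ℝ 1 (P i)) (a b : ι → ℝ) :
    tform m L (fun X => ∑ i ∈ s, (a i : ℂ) * P i X) (fun X => ∑ i ∈ s, (b i : ℂ) * P i X) =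
      ∑ i ∈ s, ∑ j ∈ s, ((a i * b j : ℝ) : ℂ) * tform m L (P i) (P j) := by
  have hF : ∀ (c : ι → ℝ), ∀ i ∈ s, ContDiff ℝ 1 (fun X => (c i : ℂ) * P i X) := fun c i hi =>
    contDiff_const.mul (hP i hi)
  rw [blockSum_eq, blockSum_eq, SharpCut.tform_sum_left s (hF a) (SharpCut.contDiff_sum_fn s (hF b))]
  refine Finset.sum_congr rfl fun i hi => ?_
  rw [SharpCut.tform_sum_right s (hF a i hi) (hF b)]
  refine Finset.sum_congr rfl fun j hj => ?_
  rw [tform_const_mul_left _ ((hP i hi).differentiable one_ne_zero),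
    tform_const_mul_right _ _ ((hP j hj).differentiable one_ne_zero), Complex.conj_ofReal,
    Complex.ofReal_mul]
  ring

/-- **Sesquilinear expansion of the interaction form** over a finite family with real coefficients
(continuous data, continuous real interaction). [folklore] -/
theorem vform_sum_sum {ι : Type*} (s : Finset ι)
    (hW : Continuous fun X : Config (m + 1) => (periodicInteraction v L X).toReal)
    {P : ι → Config (m + 1) → ℂ} (hP : ∀ i ∈ s, Continuous (P i)) (a b : ι → ℝ) :
    vform v m L (fun X => ∑ i ∈ s, (a i : ℂ) * P i X) (fun X => ∑ i ∈ s, (b i : ℂ) * P i X) =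
      ∑ i ∈ s, ∑ j ∈ s, ((a i * b j : ℝ) : ℂ) * vform v m L (P i) (P j) := by
  have hF : ∀ (c : ι → ℝ), ∀ i ∈ s, Continuous (fun X => (c i : ℂ) * P i X) := fun c i hi =>
    continuous_const.mul (hP i hi)
  rw [blockSum_eq, blockSum_eq, SharpCut.vform_sum_left s hW (hF a) (SharpCut.continuous_sum_fn s (hF b))]
  refine Finset.sum_congr rfl fun i hi => ?_
  rw [SharpCut.vform_sum_right s hW (hF a i hi) (hF b)]
  refine Finset.sum_congr rfl fun j _ => ?_
  unfold vform
  rw [PlainInteraction.form_const_mul_left, PlainInteraction.form_const_mul_right, Complex.conj_ofReal,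
    Complex.ofReal_mul]
  ring

/-- Real part of a double sum with real product coefficients. [folklore] -/
theorem re_sum_sum {ι : Type*} (s : Finset ι) (a b : ι → ℝ) (F : ι → ι → ℂ) :
    (∑ i ∈ s, ∑ j ∈ s, ((a i * b j : ℝ) : ℂ) * F i j).re = ∑ i ∈ s, ∑ j ∈ s, a i * b j * (F i j).re := by
  rw [Complex.re_sum]
  refine Finset.sum_congr rfl fun i _ => ?_
  rw [Complex.re_sum]
  exact Finset.sum_congr rfl fun j _ => Complex.re_ofReal_mul _ _

/-! ## The sector blocks `Ψ^{(n)} = Σ_{|S| = n} Q_S ψ` -/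

/-- **A smooth block is a combination of the `N + 1` sector blocks**:
`χ(n̂₀/N)ψ = Σ_{n ≤ N} χ(n/N) Ψ^{(n)}`. [folklore] -/
theorem smoothBlock_eq_sum (χ : ℝ → ℝ) (ψ : Config (m + 1) → ℂ) :
    smoothBlock m L χ ψ = fun X => ∑ n ∈ Finset.range (m + 2),
      (χ ((n : ℝ) / ((m : ℝ) + 1)) : ℂ) * sectorBlock m L (fun i => i = n) ψ X := by
  funext X
  unfold smoothBlock sectorBlock
  simp only [Finset.sum_apply, Finset.mul_sum]
  symm
  calc ∑ n ∈ Finset.range (m + 2), ∑ S ∈ Finset.univ.filter (fun S : Finset (Fin (m + 1)) => S.card = n),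
        (χ ((n : ℝ) / ((m : ℝ) + 1)) : ℂ) * modeProj (m + 1) L S ψ X
      = ∑ n ∈ Finset.range (m + 2), ∑ S ∈ Finset.univ.filter (fun S : Finset (Fin (m + 1)) => S.card = n),
        (χ ((S.card : ℝ) / ((m : ℝ) + 1)) : ℂ) * modeProj (m + 1) L S ψ X :=
        Finset.sum_congr rfl fun n _ => Finset.sum_congr rfl fun S hS => by
          rw [(Finset.mem_filter.1 hS).2]
    _ = ∑ S, (χ ((S.card : ℝ) / ((m : ℝ) + 1)) : ℂ) * modeProj (m + 1) L S ψ X :=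
        Finset.sum_fiberwise_of_maps_to (fun S _ => Finset.mem_range.2
          (Nat.lt_succ_of_le ((Finset.card_le_univ S).trans_eq (Fintype.card_fin _)))) _

/-- **Resolution into sector blocks**: `ψ = Σ_{n ≤ N} Ψ^{(n)}` (written with the coefficient `1`). [folklore] -/
theorem self_eq_sum (ψ : Config (m + 1) → ℂ) :
    ψ = fun X => ∑ n ∈ Finset.range (m + 2), ((1 : ℝ) : ℂ) * sectorBlock m L (fun i => i = n) ψ X := by
  rw [← smoothBlock_eq_sum (fun _ => (1 : ℝ)) ψ]
  funext X
  unfold smoothBlock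
  simp only [Complex.ofReal_one, one_mul]
  have h := congrFun (sum_modeProj (L := L) ψ) X
  rw [Finset.sum_apply] at h
  exact h.symm

/-- **Kinetic block diagonality at the level of sectors**: `t(Ψ^{(n)}, Ψ^{(n')}) = 0` for `n ≠ n'`
(`kineticBlockDiagonal` entry by entry: `|S| ≠ |T|` forces `S ≠ T`). [folklore] -/
theorem tform_sectorBlock_ne (hL : 0 < L) {ψ : Config (m + 1) → ℂ} (hψ : ContDiff ℝ 1 ψ) {n n' : ℕ}
    (h : n ≠ n') :
    tform m L (sectorBlock m L (fun i => i = n) ψ) (sectorBlock m L (fun i => i = n') ψ) = 0 := by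
  have hQ : ∀ S : Finset (Fin (m + 1)), ContDiff ℝ 1 (modeProj (m + 1) L S ψ) := fun S =>
    contDiff_modeProj S hψ
  unfold sectorBlock
  rw [SharpCut.tform_sum_left _ (fun S _ => hQ S) (SharpCut.contDiff_sum_fn _ fun T _ => hQ T)]
  refine Finset.sum_eq_zero fun S hS => ?_
  rw [SharpCut.tform_sum_right _ (hQ S) fun T _ => hQ T]
  refine Finset.sum_eq_zero fun T hT => kineticBlockDiagonal m L hL S T (fun hST => ?_) ψ hψ
  simp only [Finset.mem_filter] at hS hT
  subst hST
  exact h (hS.2.symm.trans hT.2)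

/-- **Interaction locality at the level of sectors**: `𝓥(Ψ^{(n)}, Ψ^{(n')}) = 0` whenever `|n − n'| ≥ 3`
(`interactionLocality` entry by entry, `|T ∖ S| ≥ |T| − |S| ≥ 3`, and conjugate symmetry). [folklore] -/
theorem vform_sectorBlock_far (hv : IsRepulsiveFiniteRange v) (hfc : IsFiniteContinuous v) (hL : 0 < L)
    {ψ : Config (m + 1) → ℂ} (hψ : Continuous ψ) {n n' : ℕ} (h : n' + 3 ≤ n ∨ n + 3 ≤ n') :
    vform v m L (sectorBlock m L (fun i => i = n) ψ) (sectorBlock m L (fun i => i = n') ψ) = 0 := by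
  have hW := PlainInteraction.continuous_toReal_periodicInteraction (N := m + 1) (L := L) hv hfc hL.ne'
  have hQ : ∀ S : Finset (Fin (m + 1)), Continuous (modeProj (m + 1) L S ψ) := fun S =>
    continuous_modeProj S hψ
  have key : ∀ {a b : ℕ}, a + 3 ≤ b →
      vform v m L (sectorBlock m L (fun i => i = a) ψ) (sectorBlock m L (fun i => i = b) ψ) = 0 := by
    intro a b hab
    unfold sectorBlock
    rw [SharpCut.vform_sum_left _ hW (fun S _ => hQ S) (SharpCut.continuous_sum_fn _ fun T _ => hQ T)]
    refine Finset.sum_eq_zero fun S hS => ?_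
    rw [SharpCut.vform_sum_right _ hW (hQ S) fun T _ => hQ T]
    refine Finset.sum_eq_zero fun T hT => interactionLocality v hv hfc m L hL S T ?_ ψ hψ
    simp only [Finset.mem_filter] at hS hT
    have := Finset.le_card_sdiff S T
    omega
  rcases h with h | h
  · rw [PlainCost.vform_conj_symm, key h, map_zero]
  · exact key h

/-! ## Finiteness for finite continuous profiles; weighted Cauchy–Schwarz -/

/-- `∫⁻ V|h|² = ofReal (Re 𝓥(h, h))` for continuous `h` and a finite continuous finite-range profile (the
periodisation is finite everywhere, `PlainInteraction.periodizedPotential_ne_top`). [folklore] -/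
theorem lintegral_W_eq (hv : IsRepulsiveFiniteRange v) (hfc : IsFiniteContinuous v) (hL : L ≠ 0)
    {h : Config (m + 1) → ℂ} (hh : Continuous h) :
    ∫⁻ X in cellN (m + 1) L, periodicInteraction v L X * ((‖h X‖₊ : ℝ≥0∞)) ^ 2 =
      ENNReal.ofReal (vform v m L h h).re := by
  rw [PlainCost.vform_self, Complex.ofReal_re,
    PlainInteraction.ofReal_integral_weight_norm_sq
      (PlainInteraction.continuous_toReal_periodicInteraction hv hfc hL) (fun X => ENNReal.toReal_nonneg) hh]
  exact lintegral_congr fun X => by rw [ENNReal.ofReal_toReal (a := periodicInteraction v L X)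
    (ENNReal.sum_ne_top.2 fun p _ => ENNReal.sum_ne_top.2 fun q _ =>
      PlainInteraction.periodizedPotential_ne_top hv hfc hL _)]

/-- The energy form of a `C¹` function is finite for a finite continuous finite-range profile. [folklore] -/
theorem eform_ne_top (hv : IsRepulsiveFiniteRange v) (hfc : IsFiniteContinuous v) (hL : L ≠ 0)
    {h : Config (m + 1) → ℂ} (hh : ContDiff ℝ 1 h) : eform v L h ≠ ⊤ := by
  rw [Bare.eform_eq_add, PlainCost.lintegral_kineticDensity_eq_ofReal hh,
    lintegral_W_eq hv hfc hL hh.continuous]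
  exact ENNReal.add_ne_top.2 ⟨ENNReal.ofReal_ne_top, ENNReal.ofReal_ne_top⟩

/-- **Weighted Cauchy–Schwarz and AM–GM**: `|Re 𝓥(f, g)| ≤ (Re 𝓥(f, f) + Re 𝓥(g, g))/2` for continuous
`f, g` and a finite continuous finite-range profile. [folklore] -/
theorem abs_re_vform_le (hv : IsRepulsiveFiniteRange v) (hfc : IsFiniteContinuous v) (hL : L ≠ 0)
    {f g : Config (m + 1) → ℂ} (hf : Continuous f) (hg : Continuous g) :
    |(vform v m L f g).re| ≤ ((vform v m L f f).re + (vform v m L g g).re) / 2 := by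
  have hW := PlainInteraction.continuous_toReal_periodicInteraction (N := m + 1) (L := L) hv hfc hL
  have h := PlainInteraction.norm_form_le_sqrt_mul_sqrt (L := L) hW (fun X => ENNReal.toReal_nonneg) hf hg
  change ‖vform v m L f g‖ ≤ _ at h
  rw [PlainCost.vform_self, PlainCost.vform_self, Complex.ofReal_re, Complex.ofReal_re]
  set a := ∫ X in cellN (m + 1) L, (periodicInteraction v L X).toReal * ‖f X‖ ^ 2
  set b := ∫ X in cellN (m + 1) L, (periodicInteraction v L X).toReal * ‖g X‖ ^ 2
  have h0 : ∀ u : Config (m + 1) → ℂ, 0 ≤ ∫ X in cellN (m + 1) L, (periodicInteraction v L X).toReal * ‖u X‖ ^ 2 :=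
    fun u => integral_nonneg fun X => mul_nonneg ENNReal.toReal_nonneg (sq_nonneg _)
  have hab : Real.sqrt a * Real.sqrt b ≤ (a + b) / 2 := by
    nlinarith [sq_nonneg (Real.sqrt a - Real.sqrt b), Real.sq_sqrt (h0 f), Real.sq_sqrt (h0 g)]
  exact ((Complex.abs_re_le_norm _).trans h).trans hab

/-! ## The combinatorial core: a bandwidth-two matrix against a Lipschitz partition of unity -/

/-- At most five indices lie within distance two of a given one. [folklore] -/
theorem sum_near_le (R : Finset ℕ) (n : ℕ) (p : ℕ → Prop) [DecidablePred p]
    (hp : ∀ n', p n' → n ≤ n' + 2 ∧ n' ≤ n + 2) : (∑ n' ∈ R, if p n' then (1 : ℝ) else 0) ≤ 5 := by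
  rw [Finset.sum_boole]
  have h : R.filter p ⊆ Finset.Icc (n - 2) (n + 2) := fun n' hn' => by
    have := hp n' (Finset.mem_filter.1 hn').2
    simp only [Finset.mem_Icc]
    omega
  have h2 := (Finset.card_le_card h).trans_eq (Nat.card_Icc _ _)
  exact_mod_cast (show (R.filter p).card ≤ 5 by omega)

/-- **The IMS bound for a bandwidth-two matrix**: if `c_L² + c_H² = 1`, the squared increments of `(c_L, c_H)` over
index distance `≤ 2` are `≤ K`, and the entries `ρ(n, n')` vanish for `|n − n'| ≥ 3` and satisfy `|ρ| ≤ (D_n + D_{n'})/2`,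
`D ≥ 0`, then `Σ_{n,n'} (c_L(n)c_L(n') + c_H(n)c_H(n') − 1) ρ(n, n') ≤ (5K/2) Σ_n D_n` (five neighbours a row). [folklore] -/
theorem ims_sum_le (R : Finset ℕ) (cL cH D : ℕ → ℝ) (ρ : ℕ → ℕ → ℝ) {K : ℝ} (hK : 0 ≤ K)
    (hunit : ∀ n, cL n ^ 2 + cH n ^ 2 = 1)
    (hlip : ∀ n n', n ≤ n' + 2 → n' ≤ n + 2 → (cL n - cL n') ^ 2 + (cH n - cH n') ^ 2 ≤ K)
    (hfar : ∀ n n', n' + 3 ≤ n ∨ n + 3 ≤ n' → ρ n n' = 0)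
    (hcs : ∀ n n', |ρ n n'| ≤ (D n + D n') / 2) (hD : ∀ n ∈ R, 0 ≤ D n) :
    ∑ n ∈ R, ∑ n' ∈ R, (cL n * cL n' + cH n * cH n' - 1) * ρ n n' ≤ 5 / 2 * K * ∑ n ∈ R, D n := by
  set χ : ℕ → ℕ → ℝ := fun n n' => if n ≤ n' + 2 ∧ n' ≤ n + 2 then 1 else 0 with hχ
  have hterm : ∀ n n', (cL n * cL n' + cH n * cH n' - 1) * ρ n n' ≤
      K / 4 * (D n * χ n n') + K / 4 * (D n' * χ n n') := by
    intro n n'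
    by_cases hnear : n ≤ n' + 2 ∧ n' ≤ n + 2
    · have hχ1 : χ n n' = 1 := if_pos hnear
      have hcoef : cL n * cL n' + cH n * cH n' - 1 =
          -(1 / 2) * ((cL n - cL n') ^ 2 + (cH n - cH n') ^ 2) := by
        linear_combination (1 / 2) * hunit n + (1 / 2) * hunit n'
      rw [hχ1, mul_one, mul_one, hcoef]
      have hκ0 : 0 ≤ (cL n - cL n') ^ 2 + (cH n - cH n') ^ 2 := by positivity
      have h1 : 0 ≤ |ρ n n'| + ρ n n' := by linarith [neg_abs_le (ρ n n')]
      have h2 : 0 ≤ (D n + D n') / 2 - |ρ n n'| := by linarith [hcs n n']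
      nlinarith [mul_nonneg hκ0 h1, mul_nonneg (sub_nonneg.2 (hlip n n' hnear.1 hnear.2)) (abs_nonneg (ρ n n')),
        mul_nonneg hK h2]
    · have hχ0 : χ n n' = 0 := if_neg hnear
      rw [hχ0, hfar n n' (by omega)]
      simp
  have hrow : ∀ n ∈ R, ∑ n' ∈ R, χ n n' ≤ 5 := fun n _ => sum_near_le R n _ fun n' h => h
  have hcol : ∀ n' ∈ R, ∑ n ∈ R, χ n n' ≤ 5 := fun n' _ => sum_near_le R n' _ fun n h => ⟨h.2, h.1⟩
  have e : ∀ s : Finset ℕ, ∑ n ∈ s, K / 4 * (D n * 5) = 5 / 4 * K * ∑ n ∈ s, D n := fun s => by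
    rw [Finset.mul_sum]
    exact Finset.sum_congr rfl fun n _ => by ring
  calc ∑ n ∈ R, ∑ n' ∈ R, (cL n * cL n' + cH n * cH n' - 1) * ρ n n'
      ≤ ∑ n ∈ R, ∑ n' ∈ R, (K / 4 * (D n * χ n n') + K / 4 * (D n' * χ n n')) :=
        Finset.sum_le_sum fun n _ => Finset.sum_le_sum fun n' _ => hterm n n'
    _ = ∑ n ∈ R, ∑ n' ∈ R, K / 4 * (D n * χ n n') + ∑ n ∈ R, ∑ n' ∈ R, K / 4 * (D n' * χ n n') := by
        rw [← Finset.sum_add_distrib]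
        exact Finset.sum_congr rfl fun n _ => Finset.sum_add_distrib
    _ = ∑ n ∈ R, K / 4 * (D n * ∑ n' ∈ R, χ n n') + ∑ n' ∈ R, K / 4 * (D n' * ∑ n ∈ R, χ n n') := by
        congr 1
        · simp only [Finset.mul_sum]
        · rw [Finset.sum_comm]
          simp only [Finset.mul_sum]
    _ ≤ ∑ n ∈ R, K / 4 * (D n * 5) + ∑ n' ∈ R, K / 4 * (D n' * 5) :=
        add_le_add
          (Finset.sum_le_sum fun n hn => mul_le_mul_of_nonneg_left
            (mul_le_mul_of_nonneg_left (hrow n hn) (hD n hn)) (by positivity))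
          (Finset.sum_le_sum fun n hn => mul_le_mul_of_nonneg_left
            (mul_le_mul_of_nonneg_left (hcol n hn) (hD n hn)) (by positivity))
    _ = 5 / 2 * K * ∑ n ∈ R, D n := by rw [e]; ring

end SmoothCut

open Literature.MathematicalPhysics.QuantumManyBody.BoseGas in
open Summit.AtomisticToContinuum.BoseEinsteinCondensation.Cruxes.GDTransfer.DysonDressedWitness in
/-- **The smooth splitting inequality** (registered sub-goal `smoothSplitting` of the spectral seed programme,
line `seeded-continuity`, crux `GDTransfer`): for a finite continuous finite-range profile, cutting a periodic trial
state with the Lipschitz partition of unity `χ_lo² + χ_hi² = 1` across the middle band `[θ, 1 − β]` of `n̂₀/N` costs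
at most `8π²/((1−β−θ)²N²)` times the sector-pinched interaction `D(Ψ) = Σ_n ∫V|Ψ^{(n)}|²` — the IMS identity
`𝓔(χ_loΨ) + 𝓔(χ_hiΨ) − E(Ψ) = −½ Σ_{n,n'} [(χ_lo(n/N) − χ_lo(n'/N))² + (χ_hi(n/N) − χ_hi(n'/N))²] Re 𝓥(Ψ^{(n)}, Ψ^{(n')})`
in the band-diagonal `n̂₀`-grading (`kineticBlockDiagonal`: no kinetic cross terms; `interactionLocality`: only
`|n − n'| ≤ 2` talk), weighted Cauchy–Schwarz, and the Lipschitz bound `|χ(n/N) − χ(n'/N)| ≤ π|n − n'|/(2(1−β−θ)N)`.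
[folklore] (CyconFroeseKirschSimon1987 §3.1, IMS localisation; ReedSimonIV1978 §XIII.12.) -/
theorem smoothSplitting : SmoothSplitting := by
  intro v hv hfc m L hL θ β hθ hβ hθβ Ψ
  have hw : 0 < 1 - β - θ := by linarith
  have hN : (0 : ℝ) < (m : ℝ) + 1 := by positivity
  set R : Finset ℕ := Finset.range (m + 2)
  set P : ℕ → Config (m + 1) → ℂ := fun n => sectorBlock m L (fun i => i = n) Ψ.ψ
  set cL : ℕ → ℝ := fun n => cutLo θ β ((n : ℝ) / ((m : ℝ) + 1))
  set cH : ℕ → ℝ := fun n => cutHi θ β ((n : ℝ) / ((m : ℝ) + 1))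
  set F := smoothBlock m L (cutLo θ β) Ψ.ψ
  set G := smoothBlock m L (cutHi θ β) Ψ.ψ
  -- regularity; the three functions as combinations of sector blocks; finiteness
  have hP1 : ∀ n, ContDiff ℝ 1 (P n) := fun n => SectorBlock.contDiff_sectorBlock _ Ψ.contDiff
  have hPc : ∀ n, Continuous (P n) := fun n => (hP1 n).continuous
  have hW := PlainInteraction.continuous_toReal_periodicInteraction (N := m + 1) (L := L) hv hfc hL.ne'
  have hF : F = fun X => ∑ n ∈ R, (cL n : ℂ) * P n X := SmoothCut.smoothBlock_eq_sum _ _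
  have hG : G = fun X => ∑ n ∈ R, (cH n : ℂ) * P n X := SmoothCut.smoothBlock_eq_sum _ _
  have hψ : Ψ.ψ = fun X => ∑ n ∈ R, ((1 : ℝ) : ℂ) * P n X := SmoothCut.self_eq_sum _
  have hC1 : ∀ a : ℕ → ℝ, ContDiff ℝ 1 fun X => ∑ n ∈ R, (a n : ℂ) * P n X := fun a =>
    ContDiff.sum fun n _ => contDiff_const.mul (hP1 n)
  have hF1 : ContDiff ℝ 1 F := hF ▸ hC1 cL
  have hG1 : ContDiff ℝ 1 G := hG ▸ hC1 cH
  have hEF : eform v L F ≠ ⊤ := SmoothCut.eform_ne_top hv hfc hL.ne' hF1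
  have hEG : eform v L G ≠ ⊤ := SmoothCut.eform_ne_top hv hfc hL.ne' hG1
  have hEψ : eform v L Ψ.ψ ≠ ⊤ := SmoothCut.eform_ne_top hv hfc hL.ne' Ψ.contDiff
  -- the forms of block sums as double sums over sectors (real parts)
  have tre : ∀ a : ℕ → ℝ, (tform m L (fun X => ∑ n ∈ R, (a n : ℂ) * P n X) (fun X => ∑ n ∈ R, (a n : ℂ) * P n X)).re
      = ∑ n ∈ R, ∑ n' ∈ R, a n * a n' * (tform m L (P n) (P n')).re := fun a => by
    rw [SmoothCut.tform_sum_sum R (fun n _ => hP1 n), SmoothCut.re_sum_sum]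
  have vre : ∀ a : ℕ → ℝ, (vform v m L (fun X => ∑ n ∈ R, (a n : ℂ) * P n X) (fun X => ∑ n ∈ R, (a n : ℂ) * P n X)).re
      = ∑ n ∈ R, ∑ n' ∈ R, a n * a n' * (vform v m L (P n) (P n')).re := fun a => by
    rw [SmoothCut.vform_sum_sum R hW (fun n _ => hPc n), SmoothCut.re_sum_sum]
  -- regrouping of the three double sums into one
  have comb : ∀ Φ : ℕ → ℕ → ℝ,
      ∑ n ∈ R, ∑ n' ∈ R, cL n * cL n' * Φ n n' + ∑ n ∈ R, ∑ n' ∈ R, cH n * cH n' * Φ n n' -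
          ∑ n ∈ R, ∑ n' ∈ R, (1 : ℝ) * 1 * Φ n n' =
        ∑ n ∈ R, ∑ n' ∈ R, (cL n * cL n' + cH n * cH n' - 1) * Φ n n' := by
    intro Φ
    rw [← Finset.sum_add_distrib, ← Finset.sum_sub_distrib]
    refine Finset.sum_congr rfl fun n _ => ?_
    rw [← Finset.sum_add_distrib, ← Finset.sum_sub_distrib]
    exact Finset.sum_congr rfl fun n' _ => by ring
  have hunit : ∀ n, cL n ^ 2 + cH n ^ 2 = 1 := fun n => cutLo_sq_add_cutHi_sq θ β _
  -- kinetic part: the sectors are `t`-orthogonal and the diagonal coefficient vanishes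
  have kin : ∑ n ∈ R, ∑ n' ∈ R, (cL n * cL n' + cH n * cH n' - 1) * (tform m L (P n) (P n')).re = 0 := by
    refine Finset.sum_eq_zero fun n _ => Finset.sum_eq_zero fun n' _ => ?_
    rcases eq_or_ne n n' with rfl | h
    · have h1 : cL n * cL n + cH n * cH n - 1 = 0 := by linear_combination hunit n
      rw [h1, zero_mul]
    · rw [SmoothCut.tform_sectorBlock_ne hL Ψ.contDiff h, Complex.zero_re, mul_zero]
  -- interaction part: the combinatorial core with `K = 2B²`, `B = π/((1−β−θ)N)` the increment bound
  set B : ℝ := Real.pi / (((m : ℝ) + 1) * (1 - β - θ)) with hB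
  have hlip : ∀ n n' : ℕ, n ≤ n' + 2 → n' ≤ n + 2 → (cL n - cL n') ^ 2 + (cH n - cH n') ^ 2 ≤ 2 * B ^ 2 := by
    intro n n' h1 h2
    have h1' : (n : ℝ) ≤ n' + 2 := by exact_mod_cast h1
    have h2' : (n' : ℝ) ≤ n + 2 := by exact_mod_cast h2
    have hx : |(n : ℝ) / ((m : ℝ) + 1) - (n' : ℝ) / ((m : ℝ) + 1)| ≤ 2 / ((m : ℝ) + 1) := by
      rw [← sub_div, abs_div, abs_of_pos hN]
      exact div_le_div_of_nonneg_right (abs_le.2 ⟨by linarith, by linarith⟩) hN.le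
    have hB' : Real.pi / 2 * |(n : ℝ) / ((m : ℝ) + 1) - (n' : ℝ) / ((m : ℝ) + 1)| / (1 - β - θ) ≤ B :=
      calc Real.pi / 2 * |(n : ℝ) / ((m : ℝ) + 1) - (n' : ℝ) / ((m : ℝ) + 1)| / (1 - β - θ)
          ≤ Real.pi / 2 * (2 / ((m : ℝ) + 1)) / (1 - β - θ) := by gcongr
        _ = B := by rw [hB]; field_simp
    have hlo := sq_le_sq.2 (((abs_cutLo_sub_le hw ((n : ℝ) / ((m : ℝ) + 1)) ((n' : ℝ) / ((m : ℝ) + 1))).trans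
      hB').trans (le_abs_self B))
    have hhi := sq_le_sq.2 (((abs_cutHi_sub_le hw ((n : ℝ) / ((m : ℝ) + 1)) ((n' : ℝ) / ((m : ℝ) + 1))).trans
      hB').trans (le_abs_self B))
    linarith
  have hD0 : ∀ n ∈ R, 0 ≤ (vform v m L (P n) (P n)).re := fun n _ => PlainCost.vform_self_re_nonneg _
  have pot := SmoothCut.ims_sum_le R cL cH (fun n => (vform v m L (P n) (P n)).re)
    (fun n n' => (vform v m L (P n) (P n')).re) (by positivity) hunit hlip
    (fun n n' h => by rw [SmoothCut.vform_sectorBlock_far hv hfc hL Ψ.contDiff.continuous h, Complex.zero_re])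
    (fun n n' => SmoothCut.abs_re_vform_le hv hfc hL.ne' (hPc n) (hPc n')) hD0
  -- the sector-pinched interaction in real terms, and the real inequality
  set D : ℝ := ∑ n ∈ R, (vform v m L (P n) (P n)).re with hD
  have hDnn : 0 ≤ D := Finset.sum_nonneg hD0
  have hSD : sectorDiagV v m L Ψ.ψ = ENNReal.ofReal D := by
    rw [hD, ENNReal.ofReal_sum_of_nonneg hD0]
    exact Finset.sum_congr rfl fun n _ => SmoothCut.lintegral_W_eq hv hfc hL.ne' (hPc n)
  set c : ℝ := 8 * Real.pi ^ 2 / ((1 - β - θ) ^ 2 * ((m : ℝ) + 1) ^ 2) with hc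
  have hc0 : 0 ≤ c := by positivity
  have hKc : 5 / 2 * (2 * B ^ 2) ≤ c := by
    rw [hB, hc, div_pow, mul_pow, mul_comm (((m : ℝ) + 1) ^ 2), ← mul_assoc, mul_div_assoc']
    exact div_le_div_of_nonneg_right (by nlinarith [Real.pi_pos]) (by positivity)
  have key : (eform v L F).toReal + (eform v L G).toReal ≤ (eform v L Ψ.ψ).toReal + c * D := by
    rw [PlainCost.eform_toReal_eq hv.1 hF1 hEF, PlainCost.eform_toReal_eq hv.1 hG1 hEG,
      PlainCost.eform_toReal_eq hv.1 Ψ.contDiff hEψ, hψ, hF, hG, tre, tre, tre, vre, vre, vre]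
    have h1 := comb fun n n' => (tform m L (P n) (P n')).re
    have h2 := comb fun n n' => (vform v m L (P n) (P n')).re
    nlinarith [kin, pot, mul_le_mul_of_nonneg_right hKc hDnn, h1, h2]
  -- back to `ℝ≥0∞`
  rw [hSD, ← eform_trialState v Ψ, ← ENNReal.ofReal_mul hc0,
    ← ENNReal.toReal_le_toReal (ENNReal.add_ne_top.2 ⟨hEF, hEG⟩)
      (ENNReal.add_ne_top.2 ⟨hEψ, ENNReal.ofReal_ne_top⟩),
    ENNReal.toReal_add hEF hEG, ENNReal.toReal_add hEψ ENNReal.ofReal_ne_top,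
    ENNReal.toReal_ofReal (mul_nonneg hc0 hDnn)]
  exact key

end Summit.AtomisticToContinuum.BoseEinsteinCondensation.Cruxes.GDTransfer.Seeded

end
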